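import Literature.AnabelianGeometry.AbsoluteAnabelian.AbsTopIThm26vFullClosers
import Literature.AnabelianGeometry.AbsoluteAnabelian.AbsTopIThm26iiiClauseOneProofs
import HarnessLib

/-!
# [AbsTopI] Thm 2.6 (v), general form: the regime `Σ ≠ Primes` closed, and (iii) clause one discharged

S. Mochizuki, *Topics in Absolute Anabelian Geometry I: Generalities* (2012) [AbsTopI], Thm 2.6 (v),
manuscript p. 22 (lit key `paper:url-11ac98ba15fc`): "`ζ̃(Π) := ζ(Π/Θ) = [k : ℚ_p]` [...] the kernel
of the quotient `Π ↠ G` may be characterized [...] as the intersection of the open subgroups `H ⊆ Π`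
such that `ζ̃(H)/ζ̃(Π) = [Π : H]`" (typed: `FundamentalExtension.Thm26vFull`).

PROOF-ONLY sequel (no definitions, no named facts) of this seat's `AbsTopIThm26vFullClosers.lean`
(closer `MLFBase.thm26vFull_of_rank_of_thm26iii_open`, inputs (I1)–(I4)) using abc-iut-w6-d073's
`AbsTopIThm26iiiClauseOneProofs.lean` ([AbsTopI] Thm 2.6 (iii), first clause `θ²(Π) ⊆ Σ`, PROVED from
"`Π` topologically finitely generated" and "`Δ` pro-`Σ`"):

* `zetaTildeInv_eq_of_inputs'` — the abstract core with WEAKENED inputs: the rank identity of (ii)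
  and the second clause of (iii) are needed only when EVERY prime lies in `Σ` (print, p. 24 l. 10–16:
  for `Σ ≠ Primes` assertion (iv) alone gives `Θ = Δ`);
* `MLFBase.thetaSet_two_subset_of_isOpen` — (iii) clause one for EVERY open `H ⊆ Π` (w6-d073's
  `deltaInv_two_eq_zero_of_isProSet` at the open subgroups of `Π` inside `H`), i.e. input (I4).1
  DISCHARGED;
* `MLFBase.thm26vFull_of_zetaTildeInv_eq` — the "In particular" assembly, isolated;
* `MLFBase.thm26vFull_of_isProSet_of_tfg` — `E.Thm26vFull B` from (I1) `Δ` tfg, (I2) `Δ` pro-`Σ`,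
  "`Π` tfg" (Thm 2.6 (ii) clause one; = `MLFBase.isTopologicallyFinitelyGenerated_arith_of_localEPC`
  from Prop 2.2 + Tate's local Euler–Poincaré characteristic), and — ONLY IF `Σ ⊇ Primes` — the rank
  identity (I3) and (iii) clause two;
* **`MLFBase.thm26vFull_of_exists_prime_not_mem`** — for `Σ ∌ q` (some prime): `E.Thm26vFull B` from
  `Δ` tfg, `Δ` pro-`Σ`, `Π` tfg ALONE — the general-`Θ` form of Thm 2.6 (v) kernel-checked in exactly
  the regime where `Θ ≠ {1}` (there `Θ = Δ`).

HONEST FRAMING: refereed, undisputed statement; abc-iut cell, block C seat abc-iut-w6-d034 (L4-lead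
RULING #7k «THM26V-FULL-CLOSE», follow-up); nothing here bears on [IUTchIII] Cor. 3.12; typed ≠ proved
elsewhere.
-/

noncomputable section

open Topology

namespace Literature.AnabelianGeometry.AbsoluteAnabelian

universe u v

/-! ### The abstract core with weakened inputs -/

section Core

variable {Λ : Type u} [Group Λ] [TopologicalSpace Λ] [IsTopologicalGroup Λ]
variable {Γ : Type v} [Group Γ] [TopologicalSpace Γ] [IsTopologicalGroup Γ] [T2Space Γ]

omit [IsTopologicalGroup Γ] in
/-- For a continuous surjection `a : G ↠ Γ` from a compact group onto a Hausdorff group, the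
quotient of `G` by a normal subgroup EQUAL to `Ker a` is bicontinuously isomorphic to `Γ`.
[folklore] -/
private theorem nonempty_continuousMulEquiv_quotient_of_eq_ker'' [CompactSpace Λ] (a : Λ →ₜ* Γ)
    (ha : Function.Surjective a) (N : Subgroup Λ) [N.Normal] (hN : N = a.toMonoidHom.ker) :
    Nonempty (Λ ⧸ N ≃ₜ* Γ) := by
  subst hN
  let e₀ : Λ ⧸ a.toMonoidHom.ker ≃* Γ := QuotientGroup.quotientKerEquivOfSurjective a.toMonoidHom ha
  have hc : Continuous e₀ := by
    rw [← QuotientGroup.isOpenQuotientMap_mk.continuous_comp_iff]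
    have : (e₀ : Λ ⧸ a.toMonoidHom.ker → Γ) ∘ QuotientGroup.mk = a := funext fun _ => rfl
    rw [this]
    exact a.continuous
  let h : Λ ⧸ a.toMonoidHom.ker ≃ₜ Γ := hc.homeoOfEquivCompactToT2 (f := e₀.toEquiv)
  exact ⟨{ e₀ with
    continuous_toFun := h.continuous
    continuous_invFun := h.symm.continuous }⟩

/-- **The core of [AbsTopI] Thm 2.6 (v) with weakened inputs.**  Same setting as
`zetaTildeInv_eq_of_inputs` (`a : Λ ↠ Γ`, `Γ` "`G_k`-like", `Ker a` tfg and pro-`Σ`), but the rank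
identity of (ii) and the SECOND clause of (iii) are required only when every prime lies in `Σ`; the
first clause of (iii) (`θ²(Λ) ⊆ Σ`) is required always.  For `Σ ∌ q` the printed proof (p. 24
l. 10–16) uses (iv) alone: `Δ` is the unique maximal almost pro-omissive tfg closed normal subgroup,
`θ²(Λ) ⊆ Σ ≠ Primes`, so `Θ = Δ` and `Λ/Θ ≅ Γ`. [cite: MochizukiAbsTopI2012, Thm 2.6 (v) proof p.24] -/
theorem zetaTildeInv_eq_of_inputs' [CompactSpace Λ] [T2Space Λ] (a : Λ →ₜ* Γ)
    (ha : Function.Surjective a)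
    (hΓ : ∀ M : Subgroup Γ, M.Normal → IsClosed (M : Set Γ) → IsTopologicallyFinitelyGenerated M →
      IsAlmostProOmissive M → M = ⊥)
    (p : ℕ) [hp : Fact p.Prime] (D : ℕ) (hΓp : freeProlRank Γ p = ((1 + D : ℕ) : ℕ∞))
    (hΓl : ∀ (l : ℕ) [Fact l.Prime], l ≠ p → freeProlRank Γ l = 1)
    {S : Set ℕ} (hS : S ⊆ {q | q.Prime})
    (hΔfg : IsTopologicallyFinitelyGenerated a.toMonoidHom.ker)
    (hΔS : IsProSet a.toMonoidHom.ker S)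
    (hiii₁ : thetaSet Λ 2 ⊆ {l ∈ S | l.Prime})
    (hQ : (∀ q : ℕ, q.Prime → q ∈ S) →
      ∃ m : ℕ, ∀ (l : ℕ) [Fact l.Prime], freeProlRank Λ l = freeProlRank Γ l + m)
    (hiii₂ : (∀ q : ℕ, q.Prime → q ∈ S) →
      2 ≤ (thetaSet Λ 1).encard → thetaSet Λ 2 = {l | l.Prime}) :
    zetaTildeInv Λ = (D : ℕ∞) := by
  by_cases hall : ∀ q : ℕ, q.Prime → q ∈ S
  · -- every prime in `Σ`: the original core applies
    have hSP : {l ∈ S | l.Prime} = {l | l.Prime} := by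
      ext l
      simp only [Set.mem_setOf_eq, and_iff_right_iff_imp]
      exact hall l
    obtain ⟨m, hm⟩ := hQ hall
    refine zetaTildeInv_eq_of_inputs a ha hΓ p D hΓp hΓl hS hΔfg hΔS
      ⟨m, fun l _ _ => hm l⟩ ⟨hiii₁, fun h2 => ?_⟩
    rw [hiii₂ hall h2, hSP]
  · -- some prime `q ∉ Σ`: `Θ = Δ`, `Λ/Θ ≅ Γ`
    push Not at hall
    obtain ⟨q, hq, hqS⟩ := hall
    set Δ : Subgroup Λ := a.toMonoidHom.ker with hΔdef
    have hΔc : IsClosed (Δ : Set Λ) := by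
      rw [hΔdef, MonoidHom.coe_ker]
      exact isClosed_singleton.preimage a.continuous
    have step1 : ∀ N : Subgroup Λ, N.Normal → IsClosed (N : Set Λ) →
        IsTopologicallyFinitelyGenerated N → IsAlmostProOmissive N → N ≤ Δ :=
      fun N hN hNc hNfg hNapo => le_ker_of_isAlmostProOmissive a ha hΓ N hN hNc hNfg hNapo
    have hΓl' : ∀ (l : ℕ) [Fact l.Prime], l ≠ p → freeProlRank Γ l = ((1 : ℕ) : ℕ∞) := by
      intro l _ hl; rw [hΓl l hl, Nat.cast_one]
    have ζΓ : zetaInv Γ = (D : ℕ∞) := zetaInv_eq_of_freeProlRank_eq p 1 D hΓp hΓl'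
    have hΔapo : IsAlmostProOmissive Δ := by
      have htop : IsOpen (((⊤ : Subgroup Δ)) : Set Δ) := by rw [Subgroup.coe_top]; exact isOpen_univ
      refine ⟨⟨q, ⊤, hq, htop, ?_⟩⟩
      have h1 : IsProSet Δ {r | r.Prime ∧ r ≠ q} :=
        hΔS.mono fun r hr => ⟨hS hr, fun h => hqS (h ▸ hr)⟩
      let ι : Δ →ₜ* (⊤ : Subgroup Δ) := ⟨(Subgroup.topEquiv : (⊤ : Subgroup Δ) ≃* Δ).symm.toMonoidHom,
        Continuous.subtype_mk continuous_id _⟩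
      exact h1.of_surjective ι (Subgroup.topEquiv (G := Δ)).symm.surjective
    have hΔmax : IsMaximalAPONormal Λ Δ :=
      ⟨⟨inferInstance, hΔc, hΔfg, hΔapo⟩,
        fun N' hn hc hfg hapo hle => le_antisymm (step1 N' hn hc hfg hapo) hle⟩
    have huniq : ∃! N : Subgroup Λ, IsMaximalAPONormal Λ N := by
      refine ⟨Δ, hΔmax, fun N hN => ?_⟩
      obtain ⟨⟨hn, hc, hfg, hapo⟩, hmax⟩ := hN
      exact (hmax Δ inferInstance hΔc hΔfg hΔapo (step1 N hn hc hfg hapo)).symm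
    have h2 : thetaSet Λ 2 ≠ {l | l.Prime} := by
      intro h
      have hq2 : q ∈ thetaSet Λ 2 := by rw [h]; exact hq
      exact hqS (hiii₁ hq2).1
    have hΘ : thetaSubgroup Λ = Δ := thetaSubgroup_eq_of_isMaximalAPONormal Λ h2 huniq hΔmax
    have hM : (thetaSubgroup Λ).normalCore = a.toMonoidHom.ker := by
      rw [normalCore_thetaSubgroup, hΘ]
    obtain ⟨e⟩ := nonempty_continuousMulEquiv_quotient_of_eq_ker'' a ha _ hM
    unfold zetaTildeInv
    rw [zetaInv_congr_of_freeProlRank_eq (fun q _ => freeProlRank_eq_of_continuousMulEquiv e q), ζΓ]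

end Core

/-! ### The extension with MLF base data -/

namespace FundamentalExtension

variable {E : FundamentalExtension.{0}}

/-- **The inputs of the core at an open subgroup `H ⊆ Π`**, all THEOREMS of the tree: the restricted
augmentation `H ↠ G_H := aug(H)` is a continuous surjection onto a "`G_k`-like" group (elasticity of
`G_k` inside the open `G_H`, `MLFBase.eq_bot_of_isAlmostProOmissive_of_isOpen`), its kernel
`Δ ∩ H` is topologically finitely generated (open in the tfg compact `Δ`) and pro-`Σ`, and the ranks
of `G_H ≅ G_{k_H}` are `δ¹_l = 1` (`l ≠ p`), `δ¹_p = 1 + [G : G_H]·[K : ℚ_p]` (local class field theory,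
`freeProlRank_map_aug_of_rank` + `thm26_ii_delta_gal_holds`).
[cite: MochizukiAbsTopI2012, Thm 2.6 (v) proof p.24] -/
theorem MLFBase.exists_openSubgroup_inputs (B : E.MLFBase) (H : Subgroup E.arith)
    (hH : IsOpen (H : Set E.arith)) {S : Set ℕ} (hΔ : E.GeomTFG) (hΔS : IsProSet E.geom S) :
    ∃ a : H →ₜ* (H.map E.aug.toMonoidHom), Function.Surjective a ∧
      (∀ M : Subgroup (H.map E.aug.toMonoidHom), M.Normal →
        IsClosed (M : Set (H.map E.aug.toMonoidHom)) → IsTopologicallyFinitelyGenerated M →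
        IsAlmostProOmissive M → M = ⊥) ∧
      IsTopologicallyFinitelyGenerated a.toMonoidHom.ker ∧ IsProSet a.toMonoidHom.ker S ∧
      (∀ (l : ℕ) [Fact l.Prime], l ≠ B.p → freeProlRank (H.map E.aug.toMonoidHom) l = 1) ∧
      @freeProlRank (H.map E.aug.toMonoidHom) _ _ B.p B.instPrime =
        ((1 + (H.map E.aug.toMonoidHom).index * Module.finrank ℚ_[B.p] B.K : ℕ) : ℕ∞) := by
  letI := B.instPrime; letI := B.instField; letI := B.instAlgebra; letI := B.instFinite
  have hHc : IsClosed (H : Set E.arith) := H.isClosed_of_isOpen hH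
  haveI : CompactSpace H := isCompact_iff_compactSpace.mp hHc.isCompact
  haveI : CompactSpace E.geom := isCompact_iff_compactSpace.mp E.isClosed_geom.isCompact
  set GH : Subgroup E.gal := H.map E.aug.toMonoidHom with hGHdef
  haveI : Finite (E.arith ⧸ H) := Subgroup.quotient_finite_of_isOpen H hH
  haveI : H.FiniteIndex := Subgroup.finiteIndex_of_finite_quotient
  haveI : GH.FiniteIndex :=
    ⟨fun h0 => Subgroup.FiniteIndex.index_ne_zero (H := H)
      (Nat.eq_zero_of_zero_dvd (h0 ▸ Subgroup.index_map_dvd H E.aug_surjective))⟩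
  have hGHc : IsClosed (GH : Set E.gal) := by
    rw [hGHdef, Subgroup.coe_map]
    exact (hHc.isCompact.image (map_continuous E.aug)).isClosed
  have hGHo : IsOpen (GH : Set E.gal) := GH.isOpen_of_isClosed_of_finiteIndex hGHc
  let a : H →ₜ* GH :=
    ⟨E.aug.toMonoidHom.subgroupMap H,
      Continuous.subtype_mk ((map_continuous E.aug).comp continuous_subtype_val) _⟩
  have ha : Function.Surjective a := E.aug.toMonoidHom.subgroupMap_surjective H
  have hmem : ∀ y : H, y ∈ a.toMonoidHom.ker ↔ (y : E.arith) ∈ E.geom := by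
    intro y
    rw [MonoidHom.mem_ker, mem_geom, Subtype.ext_iff]
    rfl
  let e : ↥(E.geom ⊓ H) ≃ₜ* ↥(a.toMonoidHom.ker) :=
    { toFun := fun x => ⟨⟨x.1, x.2.2⟩, (hmem _).2 x.2.1⟩
      invFun := fun y => ⟨y.1.1, ⟨(hmem _).1 y.2, y.1.2⟩⟩
      left_inv := fun _ => rfl
      right_inv := fun _ => rfl
      map_mul' := fun _ _ => rfl
      continuous_toFun :=
        Continuous.subtype_mk (Continuous.subtype_mk continuous_subtype_val _) _
      continuous_invFun :=
        Continuous.subtype_mk (continuous_subtype_val.comp continuous_subtype_val) _ }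
  let V : Subgroup E.geom := (E.geom ⊓ H).subgroupOf E.geom
  have hVo : IsOpen (V : Set E.geom) := by
    have hV : (V : Set E.geom) = Subtype.val ⁻¹' (H : Set E.arith) := by
      ext x
      simp only [V, SetLike.mem_coe, Subgroup.mem_subgroupOf, Subgroup.mem_inf, Set.mem_preimage]
      exact ⟨fun h => h.2, fun h => ⟨x.2, h⟩⟩
    rw [hV]
    exact hH.preimage continuous_subtype_val
  let e₀ : V ≃* ↥(E.geom ⊓ H) := Subgroup.subgroupOfEquivOfLe inf_le_left
  let e' : V ≃ₜ* ↥(E.geom ⊓ H) :=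
    { e₀ with
      continuous_toFun := by
        refine Continuous.subtype_mk ?_ _
        exact continuous_subtype_val.comp continuous_subtype_val
      continuous_invFun := by
        refine Continuous.subtype_mk (Continuous.subtype_mk continuous_subtype_val _) _ }
  have hΔHfg : IsTopologicallyFinitelyGenerated (a.toMonoidHom.ker) :=
    ((hΔ.subgroup_isOpen V hVo).of_continuousMulEquiv e').of_continuousMulEquiv e
  have hΔHS : IsProSet (a.toMonoidHom.ker) S :=
    (E.isProSet_geom_inf_of_isOpen hΔS H hH).of_continuousMulEquiv e
  obtain ⟨hl1, hp1⟩ := freeProlRank_map_aug_of_rank thm26_ii_delta_gal_holds E B H hH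
  refine ⟨a, ha, fun M hn hc hfg hapo =>
    MLFBase.eq_bot_of_isAlmostProOmissive_of_isOpen B GH hGHo M hn hc hfg hapo, hΔHfg, hΔHS, hl1, ?_⟩
  rw [hp1, Nat.add_comm]

/-- **[AbsTopI] Thm 2.6 (iii), first clause, for EVERY open subgroup `H ⊆ Π`: `θ²(H) ⊆ Σ`** — from
abc-iut-w6-d073's `deltaInv_two_eq_zero_of_isProSet` (`δ²_l(J) = 0` for every open `J ⊆ Π`,
`l ∉ Σ`), since an open `J′ ⊆ H` is an open subgroup of `Π` ("by applying the analogue of this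
conclusion for an arbitrary open subgroup", p. 23).  Inputs: MLF base data, `Π` topologically
finitely generated (Thm 2.6 (ii) clause one), `Δ` pro-`Σ`. [cite: MochizukiAbsTopI2012, Thm 2.6 (iii) p.22] -/
theorem MLFBase.thetaSet_two_subset_of_isOpen (B : E.MLFBase) {S : Set ℕ}
    (htfg : IsTopologicallyFinitelyGenerated E.arith) (hΔS : IsProSet E.geom S)
    (H : Subgroup E.arith) (hH : IsOpen (H : Set E.arith)) :
    thetaSet H 2 ⊆ {l ∈ S | l.Prime} := by
  intro l hl
  obtain ⟨hlp, hle⟩ := hl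
  refine ⟨?_, hlp⟩
  by_contra hlS
  haveI : Fact l.Prime := ⟨hlp⟩
  have h0 : epsilonInv H 2 l = 0 := by
    refine nonpos_iff_eq_zero.mp ?_
    unfold epsilonInv
    refine iSup₂_le fun J' hJ' => ?_
    have hJo : IsOpen ((J'.map H.subtype : Subgroup E.arith) : Set E.arith) := by
      have h1 : ((J'.map H.subtype : Subgroup E.arith) : Set E.arith) = Subtype.val '' (J' : Set H) := by
        rw [Subgroup.coe_map]; rfl
      rw [h1]
      exact hH.isOpenMap_subtype_val _ hJ'
    have hmemH : ∀ y : (J'.map H.subtype : Subgroup E.arith), (y : E.arith) ∈ H := fun y => by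
      obtain ⟨x, -, hxy⟩ := y.2
      rw [← hxy]
      exact x.2
    have hmemJ : ∀ y : (J'.map H.subtype : Subgroup E.arith), (⟨(y : E.arith), hmemH y⟩ : H) ∈ J' :=
      fun y => by
      obtain ⟨x, hx, hxy⟩ := y.2
      have hx' : (⟨(y : E.arith), hmemH y⟩ : H) = x := Subtype.ext hxy.symm
      rw [hx']
      exact hx
    let e : J' ≃ₜ* (J'.map H.subtype : Subgroup E.arith) :=
      { toFun := fun x => ⟨(x : H), ⟨x, x.2, rfl⟩⟩
        invFun := fun y => ⟨⟨(y : E.arith), hmemH y⟩, hmemJ y⟩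
        left_inv := fun _ => rfl
        right_inv := fun _ => rfl
        map_mul' := fun _ _ => rfl
        continuous_toFun := (continuous_subtype_val.comp continuous_subtype_val).subtype_mk _
        continuous_invFun := (continuous_subtype_val.subtype_mk _).subtype_mk _ }
    rw [deltaInv_eq_of_continuousMulEquiv e 2 l, E.deltaInv_two_eq_zero_of_isProSet B htfg hΔS hlS hJo]
  have h1 : ((3 - 2 : ℕ) : ℕ∞) ≤ 0 := h0 ▸ hle
  norm_num at h1

/-- **The "In particular" assembly of [AbsTopI] Thm 2.6 (v)**: if `ζ̃(H) = [G : G_H]·[K : ℚ_p]` for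
every open `H ⊆ Π` and `ζ̃(Π) = [K : ℚ_p]`, then `E.Thm26vFull B` — for open `H`,
`ζ̃(H) = [Π : H]·ζ̃(Π) ⟺ [G : G_H] = [Π : H] ⟺ Δ ⊆ H`, and the closed subgroup `Δ` of the profinite
`Π` is the intersection of the open subgroups containing it. [cite: MochizukiAbsTopI2012, Thm 2.6 (v) p.22] -/
theorem MLFBase.thm26vFull_of_zetaTildeInv_eq (B : E.MLFBase)
    (hζ : ∀ (H : Subgroup E.arith), IsOpen (H : Set E.arith) →
      zetaTildeInv H = (((H.map E.aug.toMonoidHom).index * Module.finrank ℚ_[B.p] B.K : ℕ) : ℕ∞))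
    (hζtop : zetaTildeInv E.arith = (Module.finrank ℚ_[B.p] B.K : ℕ)) : E.Thm26vFull B := by
  letI := B.instPrime; letI := B.instField; letI := B.instAlgebra; letI := B.instFinite
  set d : ℕ := Module.finrank ℚ_[B.p] B.K with hd
  have hd0 : d ≠ 0 := Module.finrank_pos.ne'
  refine ⟨hζtop, ?_⟩
  have hiff : ∀ (H : Subgroup E.arith), IsOpen (H : Set E.arith) →
      (zetaTildeInv H = (H.index : ℕ∞) * zetaTildeInv E.arith ↔ E.geom ≤ H) := fun H hH => by
    haveI : Finite (E.arith ⧸ H) := Subgroup.quotient_finite_of_isOpen H hH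
    haveI : H.FiniteIndex := Subgroup.finiteIndex_of_finite_quotient
    rw [hζ H hH, hζtop, ← Nat.cast_mul, ENat.coe_inj, geom_eq_ker]
    rw [show (H.map E.aug.toMonoidHom).index * d = H.index * d ↔
        (H.map E.aug.toMonoidHom).index = H.index from
      ⟨fun h' => Nat.eq_of_mul_eq_mul_right (Nat.pos_of_ne_zero hd0) h', fun h' => by rw [h']⟩]
    refine ⟨fun h => ?_, fun h => Subgroup.index_map_eq H E.aug_surjective h⟩
    -- `[G : G_H] = [Π : H]` forces `Ker ⊆ H`
    have h1 : (H.map E.aug.toMonoidHom).index = (H ⊔ E.aug.toMonoidHom.ker).index := by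
      rw [Subgroup.index_map, MonoidHom.range_eq_top.mpr E.aug_surjective, Subgroup.index_top, mul_one]
    rw [h1] at h
    have h2 : H.relIndex (H ⊔ E.aug.toMonoidHom.ker) * (H ⊔ E.aug.toMonoidHom.ker).index = H.index :=
      Subgroup.relIndex_mul_index le_sup_left
    rw [h] at h2
    have h3 : H.relIndex (H ⊔ E.aug.toMonoidHom.ker) = 1 := by
      have hne : H.index ≠ 0 := Subgroup.FiniteIndex.index_ne_zero
      nth_rw 2 [← one_mul H.index] at h2
      exact Nat.eq_of_mul_eq_mul_right (Nat.pos_of_ne_zero hne) h2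
    exact le_sup_right.trans (Subgroup.relIndex_eq_one.mp h3)
  have hΔ' : E.geom = sInf {N : Subgroup E.arith | IsOpen (N : Set E.arith) ∧ E.geom ≤ N} :=
    ProfiniteGrp.closedSubgroup_eq_sInf_open E.geomClosed
  refine le_antisymm ?_ ?_
  · exact le_iInf fun H => le_iInf fun hH => le_iInf fun hHζ => (hiff H hH).mp hHζ
  · conv_rhs => rw [hΔ']
    refine le_sInf fun N hN => ?_
    exact iInf_le_of_le N (iInf_le_of_le hN.1 (iInf_le_of_le ((hiff N hN.1).mpr hN.2) le_rfl))

/-- **[AbsTopI] Thm 2.6 (v), general form, with (iii) clause one DISCHARGED** — for every extension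
with MLF base data `G ≅ G_K` and construction-data prime set `Σ ⊆ Primes`, GIVEN: `Δ` topologically
finitely generated (Prop 2.2, `E.GeomTFG`), `Π` topologically finitely generated (Thm 2.6 (ii) clause
one; `MLFBase.isTopologicallyFinitelyGenerated_arith_of_localEPC` from Prop 2.2 + Tate's local
Euler–Poincaré characteristic), `Δ` pro-`Σ`, and — ONLY in case every prime lies in `Σ` — the rank
identity of (ii) for every open `Π′` ("`δ¹_l(Π′) = δ¹_l(G′) + m`") and the second clause of (iii) for
every open `H` ("`|θ¹(H)| ≥ 2 ⇒ θ²(H) = Primes`").  Then `E.Thm26vFull B`.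
[cite: MochizukiAbsTopI2012, Thm 2.6 (v) p.22] -/
theorem MLFBase.thm26vFull_of_isProSet_of_tfg (B : E.MLFBase) (S : Set ℕ) (hS : S ⊆ {q | q.Prime})
    (hΔ : E.GeomTFG) (htfg : IsTopologicallyFinitelyGenerated E.arith) (hΔS : IsProSet E.geom S)
    (hQ : (∀ q : ℕ, q.Prime → q ∈ S) → ∀ (P : Subgroup E.arith), IsOpen (P : Set E.arith) →
      ∃ m : ℕ, ∀ (l : ℕ) [Fact l.Prime],
        freeProlRank P l = freeProlRank (P.map E.aug.toMonoidHom) l + m)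
    (hiii₂ : (∀ q : ℕ, q.Prime → q ∈ S) → ∀ (H : Subgroup E.arith), IsOpen (H : Set E.arith) →
      2 ≤ (thetaSet H 1).encard → thetaSet H 2 = {l | l.Prime}) :
    E.Thm26vFull B := by
  letI := B.instPrime; letI := B.instField; letI := B.instAlgebra; letI := B.instFinite
  -- every open `H`
  have hζ : ∀ (H : Subgroup E.arith), IsOpen (H : Set E.arith) →
      zetaTildeInv H =
        (((H.map E.aug.toMonoidHom).index * Module.finrank ℚ_[B.p] B.K : ℕ) : ℕ∞) := by
    intro H hH
    haveI : CompactSpace H :=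
      isCompact_iff_compactSpace.mp (H.isClosed_of_isOpen hH).isCompact
    obtain ⟨a, ha, hΓ, hfg, hpro, hl1, hp1⟩ := MLFBase.exists_openSubgroup_inputs B H hH hΔ hΔS
    exact zetaTildeInv_eq_of_inputs' a ha hΓ B.p _ hp1 hl1 hS hfg hpro
      (MLFBase.thetaSet_two_subset_of_isOpen B htfg hΔS H hH)
      (fun hall => hQ hall H hH) (fun hall => hiii₂ hall H hH)
  -- `Π` itself, transporting along `⊤ ≅ Π`
  have htop : IsOpen ((⊤ : Subgroup E.arith) : Set E.arith) := by
    rw [Subgroup.coe_top]; exact isOpen_univ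
  obtain ⟨e⟩ := nonempty_continuousMulEquiv_of_eq_top (⊤ : Subgroup E.arith) rfl
  obtain ⟨e'⟩ := nonempty_continuousMulEquiv_of_eq_top
    ((⊤ : Subgroup E.arith).map E.aug.toMonoidHom) (Subgroup.map_top_of_surjective _ E.aug_surjective)
  have hR := thm26_ii_delta_gal_holds B.p B.K
  have hl1 : ∀ (l : ℕ) [Fact l.Prime], l ≠ B.p → freeProlRank E.gal l = 1 := by
    intro l _ hl
    rw [freeProlRank_eq_of_continuousMulEquiv B.galIso l]
    exact hR.1 l hl
  have hp1 : @freeProlRank E.gal _ _ B.p B.instPrime =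
      ((1 + Module.finrank ℚ_[B.p] B.K : ℕ) : ℕ∞) := by
    rw [freeProlRank_eq_of_continuousMulEquiv B.galIso B.p, hR.2, Nat.add_comm]
  have hiii₁top : thetaSet E.arith 2 ⊆ {l ∈ S | l.Prime} := by
    rw [← thetaSet_eq_of_continuousMulEquiv e 2]
    exact MLFBase.thetaSet_two_subset_of_isOpen B htfg hΔS ⊤ htop
  have hζtop : zetaTildeInv E.arith = (Module.finrank ℚ_[B.p] B.K : ℕ) := by
    refine zetaTildeInv_eq_of_inputs' E.aug E.aug_surjective
      (fun M hn hc hfg hapo => MLFBase.eq_bot_of_isAlmostProOmissive B M hn hc hfg hapo)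
      B.p (Module.finrank ℚ_[B.p] B.K) hp1 hl1 hS hΔ hΔS hiii₁top (fun hall => ?_) (fun hall h2 => ?_)
    · obtain ⟨m, hm⟩ := hQ hall ⊤ htop
      refine ⟨m, fun l _ => ?_⟩
      rw [← freeProlRank_eq_of_continuousMulEquiv e l, hm l, freeProlRank_eq_of_continuousMulEquiv e' l]
    · rw [← thetaSet_eq_of_continuousMulEquiv e 2, ← thetaSet_eq_of_continuousMulEquiv e 1] at *
      exact hiii₂ hall ⊤ htop h2
  exact MLFBase.thm26vFull_of_zetaTildeInv_eq B hζ hζtop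

/-- **[AbsTopI] Thm 2.6 (v), GENERAL form, in the regime `Σ ≠ Primes` — kernel-checked from the
construction data alone.**  For every extension `1 → Δ → Π → G → 1` with MLF base data `G ≅ G_K`
whose `Δ` is topologically finitely generated ([AbsTopI] Prop 2.2) and pro-`Σ` for a set of primes
`Σ` MISSING at least one prime, and whose `Π` is topologically finitely generated (Thm 2.6 (ii)
clause one): `ζ̃(Π) := ζ(Π/Θ) = [k : ℚ_p]` and `Δ = ⋂ {H open | ζ̃(H)/ζ̃(Π) = [Π : H]}` — the typed
`E.Thm26vFull B`.  This is exactly the regime in which `Θ ≠ {1}` (here `Θ_H = Δ ∩ H` for every open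
`H`, by (iv) and (iii) clause one); no rank identity and no H²-injection input is needed (print
p. 24 l. 14–16: "If `Σ ≠ Primes`, then it follows from the definition of `Θ`, together with
assertion (iv), that `Θ = Δ`, hence that `ζ(Π/Θ) = ζ(G) = [k : ℚ_p]`").
[cite: MochizukiAbsTopI2012, Thm 2.6 (v) p.22] -/
theorem MLFBase.thm26vFull_of_exists_prime_not_mem (B : E.MLFBase) {S : Set ℕ}
    (hS : S ⊆ {q | q.Prime}) (hq : ∃ q : ℕ, q.Prime ∧ q ∉ S) (hΔ : E.GeomTFG)
    (htfg : IsTopologicallyFinitelyGenerated E.arith) (hΔS : IsProSet E.geom S) :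
    E.Thm26vFull B := by
  obtain ⟨q, hq, hqS⟩ := hq
  exact MLFBase.thm26vFull_of_isProSet_of_tfg B S hS hΔ htfg hΔS
    (fun hall => absurd (hall q hq) hqS) (fun hall => absurd (hall q hq) hqS)

end FundamentalExtension

end Literature.AnabelianGeometry.AbsoluteAnabelian

end
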